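import Literature.Probability.LatticeModels.KCSectionFamily
import Literature.Probability.LatticeModels.ScalingLimitCompactness
import Literature.Probability.LatticeModels.MeshDomainBulk
import Literature.Probability.LatticeModels.PlanarIsingDomainSpinorUniqueness
import HarnessLib

/-!
# Families of spin-fermion data with background spins, II: common subsequential limits of the charts and of the primitive

Topic `Literature/Probability/LatticeModels`. Chelkak–Hongler–Izyurov 2015, §3.4 (proof of
Thm 2.16, first paragraph): "by passing to a subsequence and applying the diagonal process, we can
assume that `ϑ(δ)^{-1} F_δ` tends to a limit `f̃` and `H_δ → h̃ := Re ∫ f̃²` uniformly on compact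
subsets". For a nice family with background spins (`KCSectionFamily.IsNiceCore`,
`KCSectionFamily.lean`) read through finitely many gauged charts `(U_i, σ_i)` this file produces
the limit objects along ONE subsequence of any sequence of meshes:

* `exists_strictMono_forall_finset` — common subsequences for finitely many extractable,
  subsequence-stable properties (the diagonal process); `tendstoUniformlyOn_subseq`;
* `IsNiceCore.exists_sqrt_bound_cover` — the `√δ` sup bound for the normalised section on compacts
  covered by the charts (Lebesgue number; norms are gauge-free);
* **`IsNiceCore.exists_subseq_limits`** — a subsequence along which, on every chart,
  `δ^{-1/2} gobsN_i → g_i` uniformly on compacts, `g_i` continuous and holomorphic on `U_i`;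
* **`IsNiceCore.exists_subseq_hlim`** — a further subsequence along which the normalised primitive
  `Hw/N`, read at nearest sites, converges uniformly on compacts of `⋃ U_i` to a continuous `hlim`
  (uniform bound from the clause `hbound`, asymptotic equicontinuity from the increments
  `|ΔH| = κ|F|²/N ≤ κ M² δ` along lattice staircases, and `ScalingLimitCompactness.lean`);
* **`IsNiceCore.hlim_staircase`** — in the limit, `hlim w - hlim z = -κ Im(∫_z^w g_i² dz)` along the
  staircase of every rectangle thickened inside a chart (`tendsto_hwN_staircase` + uniqueness of
  limits), whence **`IsNiceCore.hasFDerivAt_hlim`**: `d hlim = Re(q dz)` with `q = iκ g_i²`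
  (`hasFDerivAt_reMul_of_staircase`) — the form consumed by the identification theorems
  `eqOn_domainSpinorSq_of_bvp` / `eqOn_zero_of_bvp_bounded`.

Everything is proved; no named fact.

## References

* D. Chelkak, C. Hongler, K. Izyurov, Ann. of Math. 181 (2015): §3.4 (proof of Thm 2.16), Thm 3.12
  [ChelkakHonglerIzyurovAnnals2015].
-/

noncomputable section

namespace Literature.Probability.LatticeModels

open Filter _root_.Topology Metric Set Finset Complex SimpleGraph

/-! ### The diagonal process -/

/-- **Common subsequence for finitely many extractable, subsequence-stable properties.** [folklore] -/
theorem exists_strictMono_forall_finset {ι : Type*} (P : ι → (ℕ → ℕ) → Prop)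
    (hP : ∀ i (ψ : ℕ → ℕ), StrictMono ψ → ∃ φ : ℕ → ℕ, StrictMono φ ∧ P i (ψ ∘ φ))
    (hmono : ∀ i (ψ φ : ℕ → ℕ), StrictMono φ → P i ψ → P i (ψ ∘ φ)) (t : Finset ι) {ψ₀ : ℕ → ℕ} (hψ₀ : StrictMono ψ₀) :
    ∃ φ : ℕ → ℕ, StrictMono φ ∧ ∀ i ∈ t, P i (ψ₀ ∘ φ) := by
  classical
  induction t using Finset.induction_on with
  | empty => exact ⟨id, strictMono_id, fun i hi => absurd hi (Finset.notMem_empty i)⟩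
  | insert a t hat ih =>
    obtain ⟨φ, hφ, hall⟩ := ih
    obtain ⟨φ', hφ', ha⟩ := hP a (ψ₀ ∘ φ) (hψ₀.comp hφ)
    refine ⟨φ ∘ φ', hφ.comp hφ', fun i hi => ?_⟩
    rcases Finset.mem_insert.1 hi with rfl | hi
    · exact ha
    · exact hmono i (ψ₀ ∘ φ) φ' hφ' (hall i hi)

/-- Uniform convergence persists along subsequences. [folklore] -/
theorem tendstoUniformlyOn_subseq {α : Type*} {F : ℕ → ℂ → α} [PseudoMetricSpace α] {f : ℂ → α} {K : Set ℂ}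
    (h : TendstoUniformlyOn F f atTop K) {φ : ℕ → ℕ} (hφ : StrictMono φ) :
    TendstoUniformlyOn (fun k => F (φ k)) f atTop K := by
  rw [Metric.tendstoUniformlyOn_iff] at h ⊢
  exact fun ε hε => hφ.tendsto_atTop.eventually (h ε hε)

/-- Values of a uniformly convergent sequence at a convergent sequence of points. [folklore] -/
theorem tendsto_apply_of_tendstoUniformlyOn {α : Type*} [PseudoMetricSpace α] {F : ℕ → ℂ → α} {f : ℂ → α} {K : Set ℂ}
    (h : TendstoUniformlyOn F f atTop K) {w : ℂ} (hw : w ∈ K) (hf : ContinuousWithinAt f K w) {p : ℕ → ℂ}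
    (hp : Tendsto p atTop (𝓝 w)) (hpK : ∀ᶠ k in atTop, p k ∈ K) :
    Tendsto (fun k => F k (p k)) atTop (𝓝 (f w)) :=
  h.tendstoLocallyUniformlyOn.tendsto_comp hf hw (tendsto_nhdsWithin_iff.2 ⟨hp, hpK⟩)

namespace KCSectionFamily

variable {𝓕 : KCSectionFamily} {Ω A : Set ℂ} {N : ℝ → ℝ}

/-! ### The sup bound on compacts covered by the charts -/

/-- **`|F_δ| ≤ M √δ` for the normalised section on a compact covered by finitely many charts.** [cite: ChelkakHonglerIzyurovAnnals2015, Thm 3.12 (3.12)] -/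
theorem IsNiceCore.exists_sqrt_bound_cover {ι : Type*} [Fintype ι] (h : 𝓕.IsNiceCore Ω A N) {U : ι → Set ℂ} {σ : ι → ℝ → ℤ → ℝ}
    (hg : ∀ i, 𝓕.IsGauge (U i) (σ i)) (hUo : ∀ i, IsOpen (U i)) (hUA : ∀ i, U i ⊆ Ω \ A)
    {K : Set ℂ} (hK : IsCompact K) (hKW : K ⊆ ⋃ i, U i) :
    ∃ M : ℝ, 0 ≤ M ∧ ∀ᶠ δ in 𝓝[>] (0 : ℝ), ∀ x : Site 2, meshPoint δ x ∈ K → ∀ i : Fin 4, (i = 0 ∨ i = 1) →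
      ‖𝓕.obsN Ω N δ (cSrc (x, i))‖ ≤ M * Real.sqrt δ := by
  classical
  by_cases huniv : ∃ i, U i = univ
  · obtain ⟨i, hi⟩ := huniv
    exact h.exists_sqrt_bound (hg i) (hUo i) (hUA i) hK (hi ▸ subset_univ K)
  push Not at huniv
  have hne : ∀ i, (U i)ᶜ.Nonempty := fun i => nonempty_compl.2 (huniv i)
  obtain ⟨lam, hlam, hleb⟩ := lebesgue_number_lemma_of_metric hK hUo hKW
  -- the compact pieces `K_i = K ∩ {infDist · (U i)ᶜ ≥ λ}`
  set Kp : ι → Set ℂ := fun i => K ∩ {z | lam ≤ infDist z (U i)ᶜ} with hKp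
  have hKpc : ∀ i, IsCompact (Kp i) := fun i =>
    hK.inter_right (isClosed_le continuous_const (continuous_infDist_pt _))
  have hKpU : ∀ i, Kp i ⊆ U i := by
    intro i z hz
    by_contra hzU
    have h0 : infDist z (U i)ᶜ = 0 := infDist_zero_of_mem hzU
    have := hz.2
    rw [mem_setOf_eq, h0] at this
    linarith
  have hcov : ∀ z ∈ K, ∃ i, z ∈ Kp i := by
    intro z hz
    obtain ⟨i, hi⟩ := hleb z hz
    refine ⟨i, hz, (le_infDist (hne i)).2 fun y hy => ?_⟩
    by_contra hlt
    push Not at hlt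
    exact hy (hi (mem_ball'.2 hlt))
  choose M hM0 hM using fun i => h.exists_sqrt_bound (hg i) (hUo i) (hUA i) (hKpc i) (hKpU i)
  refine ⟨∑ i, M i, Finset.sum_nonneg fun i _ => hM0 i, ?_⟩
  have hall : ∀ᶠ δ in 𝓝[>] (0 : ℝ), ∀ i, ∀ x : Site 2, meshPoint δ x ∈ Kp i → ∀ j : Fin 4, (j = 0 ∨ j = 1) →
      ‖𝓕.obsN Ω N δ (cSrc (x, j))‖ ≤ M i * Real.sqrt δ := eventually_all.2 hM
  filter_upwards [hall] with δ hδ x hx j hj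
  obtain ⟨i, hi⟩ := hcov _ hx
  exact (hδ i x hi j hj).trans (mul_le_mul_of_nonneg_right
    (Finset.single_le_sum (fun k _ => hM0 k) (Finset.mem_univ i)) (Real.sqrt_nonneg _))

/-! ### Common subsequential limits of the charts -/

/-- **The diagonal process over finitely many charts**: a subsequence along which, on every chart,
`δ^{-1/2} gobsN_i` converges uniformly on compacts to a continuous, holomorphic `g_i`. [cite: ChelkakHonglerIzyurovAnnals2015, §3.4 (proof of Thm 2.16)] -/
theorem IsNiceCore.exists_subseq_limits {ι : Type*} [Fintype ι] (h : 𝓕.IsNiceCore Ω A N) {U : ι → Set ℂ} {σ : ι → ℝ → ℤ → ℝ}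
    (hg : ∀ i, 𝓕.IsGauge (U i) (σ i)) (hUo : ∀ i, IsOpen (U i)) (hUA : ∀ i, U i ⊆ Ω \ A)
    {s : ℕ → ℝ} (hs : Tendsto s atTop (𝓝[>] (0 : ℝ))) :
    ∃ φ : ℕ → ℕ, StrictMono φ ∧ ∀ i, ∃ g : ℂ → ℂ, ContinuousOn g (U i) ∧ DifferentiableOn ℂ g (U i) ∧
      ∀ K ⊆ U i, IsCompact K → TendstoUniformlyOn (fun k z => scaledEdgeFamily (𝓕.gobsN Ω N (σ i)) s (φ k) z) g atTop K := by
  classical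
  set P : ι → (ℕ → ℕ) → Prop := fun i ψ => ∃ g : ℂ → ℂ, ContinuousOn g (U i) ∧
    ∀ K ⊆ U i, IsCompact K → TendstoUniformlyOn (fun k z => scaledEdgeFamily (𝓕.gobsN Ω N (σ i)) s (ψ k) z) g atTop K with hP
  have hPex : ∀ i (ψ : ℕ → ℕ), StrictMono ψ → ∃ φ : ℕ → ℕ, StrictMono φ ∧ P i (ψ ∘ φ) := by
    intro i ψ hψ
    obtain ⟨φ, hφ, g, hgc, hconv⟩ := h.exists_subseq_limit (hg i) (hUo i) (hUA i) (s := s ∘ ψ) (hs.comp hψ.tendsto_atTop)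
    exact ⟨φ, hφ, g, hgc, hconv⟩
  have hPmono : ∀ i (ψ φ : ℕ → ℕ), StrictMono φ → P i ψ → P i (ψ ∘ φ) := by
    rintro i ψ φ hφ ⟨g, hgc, hconv⟩
    exact ⟨g, hgc, fun K hKU hK => tendstoUniformlyOn_subseq (hconv K hKU hK) hφ⟩
  obtain ⟨φ, hφ, hall⟩ := exists_strictMono_forall_finset P hPex hPmono Finset.univ strictMono_id
  refine ⟨φ, hφ, fun i => ?_⟩
  obtain ⟨g, hgc, hconv⟩ := hall i (Finset.mem_univ i)
  refine ⟨g, hgc, ?_, hconv⟩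
  exact h.differentiableOn_of_limit (hg i) (hUo i) (hUA i) (s := s ∘ φ) (hs.comp hφ.tendsto_atTop) hgc hconv

/-! ### The limit of the normalised primitive -/

/-- Coordinates of staircase vertices. [folklore] -/
theorem vtx_apply_zero (c : Site 2) (i j : ℤ) : vtx c i j 0 = c 0 + i := by
  simp [vtx]

/-- Coordinates of staircase vertices. [folklore] -/
theorem vtx_apply_one (c : Site 2) (i j : ℤ) : vtx c i j 1 = c 1 + j := by
  simp [vtx]

/-- Telescoping bound along a forward staircase: horizontal leg then vertical leg. [folklore] -/
theorem abs_sub_le_of_staircase {f : Site 2 → ℝ} {S : Set (Site 2)} {b : ℝ}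
    (hinc : ∀ y ∈ S, ∀ e : Fin 4, (e = 0 ∨ e = 1) → |f (y + cornerUnit e) - f y| ≤ b)
    (c : Site 2) (m n : ℕ) (hpath : ∀ i j : ℕ, i ≤ m → j ≤ n → vtx c i j ∈ S) :
    |f (vtx c m n) - f c| ≤ (m + n) * b := by
  have h1 := Finset.sum_range_sub (fun t : ℕ => f (vtx c t 0)) m
  have h2 := Finset.sum_range_sub (fun t : ℕ => f (vtx c m t)) n
  simp only [Nat.cast_succ, Nat.cast_zero] at h1 h2
  have htel : f (vtx c m n) - f c =
      ∑ t ∈ Finset.range m, (f (vtx c ((t : ℤ) + 1) 0) - f (vtx c t 0)) +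
        ∑ t ∈ Finset.range n, (f (vtx c m ((t : ℤ) + 1)) - f (vtx c m t)) := by
    rw [h1, h2, vtx_zero_zero]; ring
  rw [htel]
  refine (abs_add_le _ _).trans ?_
  have hb1 : |∑ t ∈ Finset.range m, (f (vtx c ((t : ℤ) + 1) 0) - f (vtx c t 0))| ≤ m * b := by
    refine (Finset.abs_sum_le_sum_abs _ _).trans ?_
    have : ∀ t ∈ Finset.range m, |f (vtx c ((t : ℤ) + 1) 0) - f (vtx c t 0)| ≤ b := by
      intro t ht
      rw [vtx_add_one_left]
      exact hinc _ (by exact_mod_cast hpath t 0 (Finset.mem_range.1 ht).le (Nat.zero_le _)) 0 (Or.inl rfl)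
    refine (Finset.sum_le_sum this).trans ?_
    simp
  have hb2 : |∑ t ∈ Finset.range n, (f (vtx c m ((t : ℤ) + 1)) - f (vtx c m t))| ≤ n * b := by
    refine (Finset.abs_sum_le_sum_abs _ _).trans ?_
    have : ∀ t ∈ Finset.range n, |f (vtx c m ((t : ℤ) + 1)) - f (vtx c m t)| ≤ b := by
      intro t ht
      rw [vtx_add_one_right]
      exact hinc _ (by exact_mod_cast hpath m t le_rfl (Finset.mem_range.1 ht).le) 1 (Or.inr rfl)
    refine (Finset.sum_le_sum this).trans ?_
    simp
  linarith

/-- The coordinates of the nearest sites of two points differ by at most `(|Δ| + 2δ)/δ`. [folklore] -/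
theorem abs_sub_nearestSite_le {δ : ℝ} (hδ : 0 < δ) (z z' : ℂ) (i : Fin 2) :
    δ * |((nearestSite δ z' i : ℤ) : ℝ) - (nearestSite δ z i : ℤ)| ≤ ‖z' - z‖ + 2 * δ := by
  have hz := dist_meshPoint_nearestSite_le hδ z
  have hz' := dist_meshPoint_nearestSite_le hδ z'
  rw [Complex.dist_eq] at hz hz'
  have key : |δ * (nearestSite δ z' i : ℝ) - δ * (nearestSite δ z i : ℝ)| ≤ ‖z' - z‖ + 2 * δ := by
    fin_cases i
    · have e1 := abs_re_le_norm (meshPoint δ (nearestSite δ z') - z')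
      have e2 := abs_re_le_norm (meshPoint δ (nearestSite δ z) - z)
      have e3 := abs_re_le_norm (z' - z)
      simp only [Complex.sub_re, meshPoint_re] at e1 e2 e3
      have := abs_sub_abs_le_abs_sub (δ * (nearestSite δ z' 0 : ℝ) - δ * (nearestSite δ z 0 : ℝ)) (z'.re - z.re)
      have h4 : |δ * ↑(nearestSite δ z' 0) - δ * ↑(nearestSite δ z 0) - (z'.re - z.re)| ≤ 2 * δ := by
        calc |δ * ↑(nearestSite δ z' 0) - δ * ↑(nearestSite δ z 0) - (z'.re - z.re)|
            = |(δ * ↑(nearestSite δ z' 0) - z'.re) - (δ * ↑(nearestSite δ z 0) - z.re)| := by ring_nf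
          _ ≤ |δ * ↑(nearestSite δ z' 0) - z'.re| + |δ * ↑(nearestSite δ z 0) - z.re| := abs_sub _ _
          _ ≤ δ + δ := add_le_add (e1.trans hz') (e2.trans hz)
          _ = 2 * δ := by ring
      simp only [Fin.zero_eta, Fin.isValue]
      linarith
    · have e1 := abs_im_le_norm (meshPoint δ (nearestSite δ z') - z')
      have e2 := abs_im_le_norm (meshPoint δ (nearestSite δ z) - z)
      have e3 := abs_im_le_norm (z' - z)
      simp only [Complex.sub_im, meshPoint_im] at e1 e2 e3
      have := abs_sub_abs_le_abs_sub (δ * (nearestSite δ z' 1 : ℝ) - δ * (nearestSite δ z 1 : ℝ)) (z'.im - z.im)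
      have h4 : |δ * ↑(nearestSite δ z' 1) - δ * ↑(nearestSite δ z 1) - (z'.im - z.im)| ≤ 2 * δ := by
        calc |δ * ↑(nearestSite δ z' 1) - δ * ↑(nearestSite δ z 1) - (z'.im - z.im)|
            = |(δ * ↑(nearestSite δ z' 1) - z'.im) - (δ * ↑(nearestSite δ z 1) - z.im)| := by ring_nf
          _ ≤ |δ * ↑(nearestSite δ z' 1) - z'.im| + |δ * ↑(nearestSite δ z 1) - z.im| := abs_sub _ _
          _ ≤ δ + δ := add_le_add (e1.trans hz') (e2.trans hz)
          _ = 2 * δ := by ring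
      simp only [Fin.mk_one, Fin.isValue]
      linarith
  rwa [← mul_sub, abs_mul, abs_of_pos hδ] at key

/-- **Asymptotic equicontinuity and boundedness of the normalised primitive on compacts covered by
the charts, and the extraction of its limit.** Along a subsequence, `Hw/N` read at nearest sites
converges uniformly on compacts of `⋃ U_i` to a continuous real function. [cite: ChelkakHonglerIzyurovAnnals2015, §3.4 ("H_δ → h̃ uniformly on compact subsets")] -/
theorem IsNiceCore.exists_subseq_hlim {ι : Type*} [Fintype ι] (h : 𝓕.IsNiceCore Ω A N) {U : ι → Set ℂ} {σ : ι → ℝ → ℤ → ℝ}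
    (hg : ∀ i, 𝓕.IsGauge (U i) (σ i)) (hUo : ∀ i, IsOpen (U i)) (hUA : ∀ i, U i ⊆ Ω \ A)
    {s : ℕ → ℝ} (hs : Tendsto s atTop (𝓝[>] (0 : ℝ))) :
    ∃ φ : ℕ → ℕ, StrictMono φ ∧ ∃ hlim : ℂ → ℝ, ContinuousOn hlim (⋃ i, U i) ∧
      ∀ K ⊆ ⋃ i, U i, IsCompact K →
        TendstoUniformlyOn (fun k z => 𝓕.HwN N (s (φ k)) (nearestSite (s (φ k)) z)) hlim atTop K := by
  classical
  set W : Set ℂ := ⋃ i, U i with hW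
  have hWo : IsOpen W := isOpen_iUnion hUo
  have hWA : W ⊆ Ω \ A := iUnion_subset hUA
  set u : ℕ → ℂ → ℂ := fun n z => (𝓕.HwN N (s n) (nearestSite (s n) z) : ℂ) with hu
  have hs0 : Tendsto s atTop (𝓝 (0 : ℝ)) := hs.mono_right nhdsWithin_le_nhds
  have hspos : ∀ᶠ n in atTop, 0 < s n := hs.eventually (self_mem_nhdsWithin)
  -- the constant `κ`
  set κ : ℝ := 1 / (Real.sqrt 2 * kcFluxConst) with hκ
  have hκ0 : 0 ≤ κ := by have := kcFluxConst_pos; positivity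
  have hs2 : Tendsto (fun n => 2 * s n) atTop (𝓝 (0 : ℝ)) := by simpa using hs0.const_mul 2
  have hbdd : ∀ K ⊆ W, IsCompact K → ∃ M : ℝ, ∀ᶠ n in atTop, ∀ z ∈ K, ‖u n z‖ ≤ M := by
    intro K hKW hK
    obtain ⟨r, hr, hrW⟩ := hK.exists_cthickening_subset_open hWo hKW
    obtain ⟨M, hM, hbd⟩ := h.hbound (cthickening r K) (hrW.trans hWA) hK.cthickening
    refine ⟨M, ?_⟩
    have hr' : ∀ᶠ δ in 𝓝[>] (0 : ℝ), δ ≤ r := nhdsWithin_le_nhds (Iic_mem_nhds hr)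
    filter_upwards [hs.eventually (hbd.and (h.pos.and (hr'.and self_mem_nhdsWithin)))] with n hn z hz
    obtain ⟨hb, hN, hrn, hn0⟩ := hn
    have hx : meshPoint (s n) (nearestSite (s n) z) ∈ cthickening r K :=
      Metric.mem_cthickening_of_dist_le _ z _ _ hz ((dist_meshPoint_nearestSite_le hn0 z).trans hrn)
    have := (hb _ hx).1
    simp only [hu, Complex.norm_real, Real.norm_eq_abs, HwN, abs_div, abs_of_pos hN]
    rwa [div_le_iff₀ hN]
  have hequi : ∀ K ⊆ W, IsCompact K → ∃ L : ℝ, 0 ≤ L ∧ ∀ᶠ n in atTop, ∀ z ∈ K, ∀ z' ∈ K,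
      ‖u n z - u n z'‖ ≤ L * (‖z - z'‖ + 2 * s n) := by
    intro K hKW hK
    obtain ⟨r₀, hr₀, hr₀W⟩ := hK.exists_cthickening_subset_open hWo hKW
    set r := r₀ / 3 with hrdef
    have hr : 0 < r := by positivity
    set K₂ := cthickening r₀ K with hK₂
    have hK₂c : IsCompact K₂ := hK.cthickening
    obtain ⟨M, hM, hbd⟩ := h.hbound K₂ (hr₀W.trans hWA) hK₂c
    obtain ⟨M', hM'0, hsup⟩ := h.exists_sqrt_bound_cover hg hUo hUA hK₂c hr₀W
    have hincr := h.hwN_increment_near (σ := fun _ _ => 1) (fun _ _ => Or.inl rfl) hK₂c (hr₀W.trans hWA)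
    set L : ℝ := 4 * (κ * M' ^ 2) + 8 * M / r with hL
    refine ⟨L, by positivity, ?_⟩
    have hr' : ∀ᶠ δ in 𝓝[>] (0 : ℝ), δ < r / 8 := nhdsWithin_le_nhds (Iio_mem_nhds (by positivity))
    filter_upwards [hs.eventually ((hbd.and (hsup.and hincr)).and (h.pos.and (hr'.and self_mem_nhdsWithin)))] with n hn z hz z' hz'
    obtain ⟨⟨hb, hsp, hinc⟩, hN, hrn, hn0⟩ := hn
    set δ := s n with hδdef
    -- the increment bound at sites with mesh point in `K₂`
    have hstep : ∀ y : Site 2, meshPoint δ y ∈ K₂ → ∀ e : Fin 4, (e = 0 ∨ e = 1) →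
        |𝓕.HwN N δ (y + cornerUnit e) - 𝓕.HwN N δ y| ≤ κ * M' ^ 2 * δ := by
      intro y hy e he
      rw [hinc y hy e, one_mul, abs_mul, abs_neg, abs_of_nonneg hκ0, mul_assoc]
      refine mul_le_mul_of_nonneg_left ?_ hκ0
      have hn1 : ‖𝓕.gobsN Ω N (fun _ _ => 1) δ (cSrc (y, e))‖ ≤ M' * Real.sqrt δ := by
        rw [norm_gobsN (fun _ _ => Or.inl rfl)]; exact hsp y hy e he
      calc |(I ^ (e : ℕ) * 𝓕.gobsN Ω N (fun _ _ => 1) δ (cSrc (y, e)) ^ 2).im|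
          ≤ ‖I ^ (e : ℕ) * 𝓕.gobsN Ω N (fun _ _ => 1) δ (cSrc (y, e)) ^ 2‖ := Complex.abs_im_le_norm _
        _ = ‖𝓕.gobsN Ω N (fun _ _ => 1) δ (cSrc (y, e))‖ ^ 2 := by rw [norm_mul, norm_pow, Complex.norm_I, one_pow, one_mul, norm_pow]
        _ ≤ (M' * Real.sqrt δ) ^ 2 := by gcongr
        _ = M' ^ 2 * δ := by rw [mul_pow, Real.sq_sqrt hn0.le]
    -- sup bound on `u n` at points of `K`
    have hval : ∀ w ∈ K, |𝓕.HwN N δ (nearestSite δ w)| ≤ M := by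
      intro w hw
      have hx : meshPoint δ (nearestSite δ w) ∈ K₂ :=
        Metric.mem_cthickening_of_dist_le _ w _ _ hw ((dist_meshPoint_nearestSite_le hn0 w).trans (by linarith))
      have := (hb _ hx).1
      rw [HwN, abs_div, abs_of_pos hN, div_le_iff₀ hN]; exact this
    have hnorm : ‖u n z - u n z'‖ = |𝓕.HwN N δ (nearestSite δ z) - 𝓕.HwN N δ (nearestSite δ z')| := by
      simp only [hu, ← Complex.ofReal_sub, Complex.norm_real, Real.norm_eq_abs, hδdef]
    rw [hnorm]
    by_cases hfar : r / 4 ≤ ‖z - z'‖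
    · -- far points: the sup bound
      have h1 : |𝓕.HwN N δ (nearestSite δ z) - 𝓕.HwN N δ (nearestSite δ z')| ≤ 2 * M := by
        have := hval z hz; have := hval z' hz'
        calc |𝓕.HwN N δ (nearestSite δ z) - 𝓕.HwN N δ (nearestSite δ z')|
            ≤ |𝓕.HwN N δ (nearestSite δ z)| + |𝓕.HwN N δ (nearestSite δ z')| := abs_sub _ _
          _ ≤ M + M := add_le_add (hval z hz) (hval z' hz')
          _ = 2 * M := by ring
      have h2 : 2 * M ≤ L * (‖z - z'‖ + 2 * s n) := by
        have hκM : 0 ≤ 4 * (κ * M' ^ 2) := by positivity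
        calc 2 * M = (8 * M / r) * (r / 4) := by field_simp; ring
          _ ≤ (8 * M / r) * (‖z - z'‖ + 2 * s n) := by
              apply mul_le_mul_of_nonneg_left _ (by positivity); linarith [hn0.le]
          _ ≤ L * (‖z - z'‖ + 2 * s n) := by
              apply mul_le_mul_of_nonneg_right _ (by positivity)
              rw [hL]; linarith
      exact h1.trans h2
    · -- close points: two forward staircases from the lower-left corner of the box
      push Not at hfar
      set x := nearestSite δ z with hx
      set x' := nearestSite δ z' with hx'
      set c : Site 2 := ![min (x 0) (x' 0), min (x 1) (x' 1)] with hc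
      have hc0 : c 0 = min (x 0) (x' 0) := rfl
      have hc1 : c 1 = min (x 1) (x' 1) := rfl
      -- the box radius
      have hd0 := abs_sub_nearestSite_le hn0 z z' 0
      have hd1 := abs_sub_nearestSite_le hn0 z z' 1
      rw [← hx, ← hx'] at hd0 hd1
      set R : ℤ := |x' 0 - x 0| + |x' 1 - x 1| with hR
      have hR0 : 0 ≤ R := by positivity
      have hRδ : δ * (R : ℝ) ≤ 2 * (‖z' - z‖ + 2 * δ) := by
        rw [hR]; push_cast; rw [mul_add]
        have : ‖z' - z‖ = ‖z - z'‖ := norm_sub_rev _ _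
        linarith
      -- all staircase points lie in `latticeBall x R`, hence have mesh points in `K₂`
      have hball : ∀ y ∈ latticeBall x R, meshPoint δ y ∈ K₂ := by
        intro y hy
        have hd := KCFamily.dist_meshPoint_le_of_mem_latticeBall hn0.le hy
        refine Metric.mem_cthickening_of_dist_le _ z _ _ hz ?_
        have hzz : ‖z' - z‖ < r / 4 := by rw [norm_sub_rev]; exact hfar
        calc dist (meshPoint δ y) z ≤ dist (meshPoint δ y) (meshPoint δ x) + dist (meshPoint δ x) z := dist_triangle _ _ _
          _ ≤ δ * (2 * R) + δ := add_le_add hd (dist_meshPoint_nearestSite_le hn0 z)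
          _ ≤ r₀ := by rw [hrdef] at hrn hzz; nlinarith [hRδ, hn0.le]
      -- elementary facts about the corner `c`
      have habs0 : x 0 - x' 0 ≤ |x' 0 - x 0| ∧ x' 0 - x 0 ≤ |x' 0 - x 0| :=
        ⟨by rw [abs_sub_comm]; exact le_abs_self _, le_abs_self _⟩
      have habs1 : x 1 - x' 1 ≤ |x' 1 - x 1| ∧ x' 1 - x 1 ≤ |x' 1 - x 1| :=
        ⟨by rw [abs_sub_comm]; exact le_abs_self _, le_abs_self _⟩
      have hcf0 : c 0 ≤ x 0 ∧ c 0 ≤ x' 0 ∧ x 0 - c 0 ≤ |x' 0 - x 0| ∧ x' 0 - c 0 ≤ |x' 0 - x 0| := by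
        rw [hc0]
        rcases le_total (x 0) (x' 0) with hle | hle
        · rw [min_eq_left hle]; exact ⟨le_rfl, hle, by linarith [abs_nonneg (x' 0 - x 0)], habs0.2⟩
        · rw [min_eq_right hle]; exact ⟨hle, le_rfl, habs0.1, by linarith [abs_nonneg (x' 0 - x 0)]⟩
      have hcf1 : c 1 ≤ x 1 ∧ c 1 ≤ x' 1 ∧ x 1 - c 1 ≤ |x' 1 - x 1| ∧ x' 1 - c 1 ≤ |x' 1 - x 1| := by
        rw [hc1]
        rcases le_total (x 1) (x' 1) with hle | hle
        · rw [min_eq_left hle]; exact ⟨le_rfl, hle, by linarith [abs_nonneg (x' 1 - x 1)], habs1.2⟩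
        · rw [min_eq_right hle]; exact ⟨hle, le_rfl, habs1.1, by linarith [abs_nonneg (x' 1 - x 1)]⟩
      have hstairs : ∀ (p : Site 2), p = x ∨ p = x' →
          |𝓕.HwN N δ p - 𝓕.HwN N δ c| ≤ (R : ℝ) * (κ * M' ^ 2 * δ) := by
        intro p hp
        have hp0 : c 0 ≤ p 0 ∧ p 0 - c 0 ≤ |x' 0 - x 0| := by
          rcases hp with rfl | rfl
          · exact ⟨hcf0.1, hcf0.2.2.1⟩
          · exact ⟨hcf0.2.1, hcf0.2.2.2⟩
        have hp1 : c 1 ≤ p 1 ∧ p 1 - c 1 ≤ |x' 1 - x 1| := by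
          rcases hp with rfl | rfl
          · exact ⟨hcf1.1, hcf1.2.2.1⟩
          · exact ⟨hcf1.2.1, hcf1.2.2.2⟩
        set m : ℕ := (p 0 - c 0).toNat with hm
        set n' : ℕ := (p 1 - c 1).toNat with hn'
        have hmz : (m : ℤ) = p 0 - c 0 := Int.toNat_of_nonneg (by linarith [hp0.1])
        have hnz : (n' : ℤ) = p 1 - c 1 := Int.toNat_of_nonneg (by linarith [hp1.1])
        have hpv : p = vtx c m n' := by
          ext i; fin_cases i
          · show p 0 = vtx c m n' 0
            rw [vtx_apply_zero, hmz]; ring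
          · show p 1 = vtx c m n' 1
            rw [vtx_apply_one, hnz]; ring
        have key := abs_sub_le_of_staircase (f := 𝓕.HwN N δ) (S := {y | meshPoint δ y ∈ K₂}) (b := κ * M' ^ 2 * δ)
          (fun y hy e he => hstep y hy e he) c m n' (fun i j hi hj => hball _ ?_)
        · rw [← hpv] at key
          refine key.trans (mul_le_mul_of_nonneg_right ?_ (by positivity))
          have : (m : ℝ) + n' ≤ R := by
            have h1 : (m : ℤ) + n' ≤ R := by rw [hmz, hnz, hR]; linarith [hp0.2, hp1.2]
            exact_mod_cast h1
          exact this
        · rw [mem_latticeBall]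
          have him : (i : ℤ) ≤ m := by exact_mod_cast hi
          have hjn : (j : ℤ) ≤ n' := by exact_mod_cast hj
          have hi0 : (0 : ℤ) ≤ i := by exact_mod_cast Nat.zero_le i
          have hj0 : (0 : ℤ) ≤ j := by exact_mod_cast Nat.zero_le j
          have hR1 : |x' 0 - x 0| ≤ R := by rw [hR]; linarith [abs_nonneg (x' 1 - x 1)]
          have hR2 : |x' 1 - x 1| ≤ R := by rw [hR]; linarith [abs_nonneg (x' 0 - x 0)]
          intro k
          fin_cases k
          · show x 0 - R ≤ vtx c i j 0 ∧ vtx c i j 0 ≤ x 0 + R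
            rw [vtx_apply_zero]
            constructor <;> linarith [hcf0.1, hcf0.2.2.1, hp0.2, hmz]
          · show x 1 - R ≤ vtx c i j 1 ∧ vtx c i j 1 ≤ x 1 + R
            rw [vtx_apply_one]
            constructor <;> linarith [hcf1.1, hcf1.2.2.1, hp1.2, hnz]
      have h1 := hstairs x (Or.inl rfl)
      have h2 := hstairs x' (Or.inr rfl)
      have h3 : |𝓕.HwN N δ x - 𝓕.HwN N δ x'| ≤ 2 * ((R : ℝ) * (κ * M' ^ 2 * δ)) := by
        calc |𝓕.HwN N δ x - 𝓕.HwN N δ x'| = |(𝓕.HwN N δ x - 𝓕.HwN N δ c) - (𝓕.HwN N δ x' - 𝓕.HwN N δ c)| := by ring_nf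
          _ ≤ |𝓕.HwN N δ x - 𝓕.HwN N δ c| + |𝓕.HwN N δ x' - 𝓕.HwN N δ c| := abs_sub _ _
          _ ≤ _ := by linarith
      refine h3.trans ?_
      have hzz : ‖z' - z‖ = ‖z - z'‖ := norm_sub_rev _ _
      calc 2 * ((R : ℝ) * (κ * M' ^ 2 * δ)) = 2 * (κ * M' ^ 2) * (δ * R) := by ring
        _ ≤ 2 * (κ * M' ^ 2) * (2 * (‖z' - z‖ + 2 * δ)) := mul_le_mul_of_nonneg_left hRδ (by positivity)
        _ = 4 * (κ * M' ^ 2) * (‖z - z'‖ + 2 * δ) := by rw [hzz]; ring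
        _ ≤ L * (‖z - z'‖ + 2 * δ) := by
            apply mul_le_mul_of_nonneg_right _ (by positivity)
            rw [hL]; have : 0 ≤ 8 * M / r := by positivity
            linarith
        _ = L * (‖z - z'‖ + 2 * s n) := by rw [hδdef]

  obtain ⟨φ, hφ, G, hGc, hGconv⟩ := exists_subseq_tendstoUniformlyOn_of_asympEquicontinuous hWo u (fun n => 2 * s n) hs2 hbdd hequi
  refine ⟨φ, hφ, fun z => (G z).re, Complex.continuous_re.comp_continuousOn hGc, fun K hKW hK => ?_⟩
  have key := Complex.uniformContinuous_re.comp_tendstoUniformlyOn (hGconv K hKW hK)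
  refine key.congr (Eventually.of_forall fun k => ?_)
  intro z hz
  simp [hu]

/-! ### The staircase identity in the limit and the differential of `hlim` -/

/-- `δ ⌊a/δ⌋₊ → a` as `δ → 0⁺` (`a ≥ 0`). [folklore] -/
theorem tendsto_mul_natFloor_div {s : ℕ → ℝ} (hs : Tendsto s atTop (𝓝[>] (0 : ℝ))) {a : ℝ} (ha : 0 ≤ a) :
    Tendsto (fun k => s k * ⌊a / s k⌋₊) atTop (𝓝 a) := by
  have hs0 : Tendsto s atTop (𝓝 (0 : ℝ)) := hs.mono_right nhdsWithin_le_nhds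
  have hpos : ∀ᶠ k in atTop, 0 < s k := hs.eventually self_mem_nhdsWithin
  have hlow : Tendsto (fun k => a - s k) atTop (𝓝 a) := by simpa using tendsto_const_nhds.sub hs0
  refine tendsto_of_tendsto_of_tendsto_of_le_of_le' hlow tendsto_const_nhds ?_ ?_
  · filter_upwards [hpos] with k hk
    have := (floor_mul_le_of_le ha hk).2
    nlinarith
  · filter_upwards [hpos] with k hk
    have := (floor_mul_le_of_le ha hk).1
    linarith [mul_comm (s k) (⌊a / s k⌋₊ : ℝ)]

/-- The far corner of the lattice staircase converges to `w`. [folklore] -/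
theorem tendsto_meshPoint_vtx {s : ℕ → ℝ} (hs : Tendsto s atTop (𝓝[>] (0 : ℝ))) {z w : ℂ} (hre : z.re ≤ w.re) (him : z.im ≤ w.im) :
    Tendsto (fun k => meshPoint (s k) (vtx (nearestSite (s k) z) (⌊(w.re - z.re) / s k⌋₊) (⌊(w.im - z.im) / s k⌋₊))) atTop (𝓝 w) := by
  have hs0 : Tendsto s atTop (𝓝 (0 : ℝ)) := hs.mono_right nhdsWithin_le_nhds
  have hpos : ∀ᶠ k in atTop, 0 < s k := hs.eventually self_mem_nhdsWithin
  have h1 : Tendsto (fun k => meshPoint (s k) (nearestSite (s k) z)) atTop (𝓝 z) := by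
    rw [tendsto_iff_dist_tendsto_zero]
    exact squeeze_zero' (Eventually.of_forall fun k => dist_nonneg)
      (hpos.mono fun k hk => dist_meshPoint_nearestSite_le hk z) hs0
  have h2 : Tendsto (fun k => (((s k * ⌊(w.re - z.re) / s k⌋₊ : ℝ)) : ℂ)) atTop (𝓝 (((w.re - z.re : ℝ)) : ℂ)) :=
    (Complex.continuous_ofReal.tendsto _).comp (tendsto_mul_natFloor_div hs (by linarith))
  have h3 : Tendsto (fun k => (((s k * ⌊(w.im - z.im) / s k⌋₊ : ℝ)) : ℂ)) atTop (𝓝 (((w.im - z.im : ℝ)) : ℂ)) :=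
    (Complex.continuous_ofReal.tendsto _).comp (tendsto_mul_natFloor_div hs (by linarith))
  have hsum := h1.add (h2.add (h3.mul_const I))
  have hw : z + ((((w.re - z.re : ℝ)) : ℂ) + (((w.im - z.im : ℝ)) : ℂ) * I) = w := by
    apply Complex.ext <;> simp
  rw [hw] at hsum
  refine hsum.congr fun k => ?_
  rw [meshPoint_vtx]
  push_cast
  ring

/-- **The staircase identity in the limit**: along a sequence of meshes on which the gauged
normalised section of a chart converges to `g` and the normalised primitive converges to `hlim`,
`hlim w - hlim z = -κ Im(∫_{Re z}^{Re w} g²(x + i Im z) dx + i ∫_{Im z}^{Im w} g²(Re w + iy) dy)`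
for every rectangle with ordered corners thickened inside the chart. [cite: ChelkakHonglerIzyurovAnnals2015, §3.4 (H_δ → h̃ = Re ∫ f̃²)] -/
theorem IsNiceCore.hlim_staircase (h : 𝓕.IsNiceCore Ω A N) {U : Set ℂ} {σ : ℝ → ℤ → ℝ} (hg : 𝓕.IsGauge U σ)
    (hUo : IsOpen U) (hUA : U ⊆ Ω \ A) {s : ℕ → ℝ} (hs : Tendsto s atTop (𝓝[>] (0 : ℝ))) {g : ℂ → ℂ} (hgc : ContinuousOn g U)
    (hconv : ∀ K ⊆ U, IsCompact K → TendstoUniformlyOn (scaledEdgeFamily (𝓕.gobsN Ω N σ) s) g atTop K)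
    {hlim : ℂ → ℝ} (hlc : ContinuousOn hlim U)
    (hH : ∀ K ⊆ U, IsCompact K → TendstoUniformlyOn (fun k z => 𝓕.HwN N (s k) (nearestSite (s k) z)) hlim atTop K)
    {z w : ℂ} (hre : z.re ≤ w.re) (him : z.im ≤ w.im) {r : ℝ} (hr : 0 < r) (hRU : cthickening r (Rectangle z w) ⊆ U) :
    hlim w - hlim z = -(1 / (Real.sqrt 2 * kcFluxConst)) *
      ((∫ x : ℝ in z.re..w.re, g (x + z.im * I) ^ 2) + I * ∫ y : ℝ in z.im..w.im, g (w.re + y * I) ^ 2).im := by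
  set K := cthickening r (Rectangle z w) with hK
  have hRc : IsCompact (Rectangle z w) := isCompact_uIcc.reProdIm isCompact_uIcc
  have hKc : IsCompact K := hRc.cthickening
  have hs0 : Tendsto s atTop (𝓝 (0 : ℝ)) := hs.mono_right nhdsWithin_le_nhds
  have hpos : ∀ᶠ k in atTop, 0 < s k := hs.eventually self_mem_nhdsWithin
  have lim1 := h.tendsto_hwN_staircase hg hUo hUA hs hre him hKc hRU (hgc.mono hRU) hr Subset.rfl (hconv K hRU hKc)
  rw [one_pow, one_mul] at lim1
  -- the same sequence converges to `hlim w - hlim z`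
  have hzK : z ∈ K := self_subset_cthickening _ ⟨left_mem_uIcc, left_mem_uIcc⟩
  have hwK : w ∈ K := self_subset_cthickening _ ⟨right_mem_uIcc, right_mem_uIcc⟩
  have hHK := hH K hRU hKc
  have limz : Tendsto (fun k => 𝓕.HwN N (s k) (nearestSite (s k) z)) atTop (𝓝 (hlim z)) := hHK.tendsto_at hzK
  have hsmall : ∀ᶠ k in atTop, 3 * s k ≤ r := by
    have : ∀ᶠ δ in 𝓝[>] (0 : ℝ), δ ≤ r / 3 := nhdsWithin_le_nhds (Iic_mem_nhds (by positivity))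
    filter_upwards [hs.eventually this] with k hk; linarith
  have limw : Tendsto (fun k => 𝓕.HwN N (s k) (vtx (nearestSite (s k) z) (⌊(w.re - z.re) / s k⌋₊) (⌊(w.im - z.im) / s k⌋₊)))
      atTop (𝓝 (hlim w)) := by
    have hp := tendsto_meshPoint_vtx hs hre him
    have hpK : ∀ᶠ k in atTop, meshPoint (s k) (vtx (nearestSite (s k) z) (⌊(w.re - z.re) / s k⌋₊) (⌊(w.im - z.im) / s k⌋₊)) ∈ K := by
      filter_upwards [hpos, hsmall] with k hk hk3
      exact cthickening_mono hk3 _ (meshPoint_vtx_mem_cthickening hk z w hre him (by omega) (by omega) (by omega) (by omega))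
    have hcw : ContinuousWithinAt hlim K w := (hlc.continuousWithinAt (hRU hwK)).mono hRU
    have key := tendsto_apply_of_tendstoUniformlyOn hHK hwK hcw hp hpK
    refine key.congr' ?_
    filter_upwards [hpos] with k hk
    simp only [nearestSite_meshPoint hk.ne']
  exact tendsto_nhds_unique (limw.sub limz) lim1

/-- **`d hlim = Re(q dz)` with `q = iκ g²`** at every point of the chart, in the form consumed by
`eqOn_domainSpinorSq_of_bvp` / `eqOn_zero_of_bvp_bounded`. [cite: ChelkakHonglerIzyurovAnnals2015, §3.4 (h̃ = Re ∫ f̃²)] -/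
theorem IsNiceCore.hasFDerivAt_hlim (h : 𝓕.IsNiceCore Ω A N) {U : Set ℂ} {σ : ℝ → ℤ → ℝ} (hg : 𝓕.IsGauge U σ)
    (hUo : IsOpen U) (hUA : U ⊆ Ω \ A) {s : ℕ → ℝ} (hs : Tendsto s atTop (𝓝[>] (0 : ℝ))) {g : ℂ → ℂ} (hgc : ContinuousOn g U)
    (hgd : DifferentiableOn ℂ g U)
    (hconv : ∀ K ⊆ U, IsCompact K → TendstoUniformlyOn (scaledEdgeFamily (𝓕.gobsN Ω N σ) s) g atTop K)
    {hlim : ℂ → ℝ} (hlc : ContinuousOn hlim U)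
    (hH : ∀ K ⊆ U, IsCompact K → TendstoUniformlyOn (fun k z => 𝓕.HwN N (s k) (nearestSite (s k) z)) hlim atTop K)
    {z₀ : ℂ} (hz₀ : z₀ ∈ U) :
    HasFDerivAt hlim (reMul ((I * (1 / (Real.sqrt 2 * kcFluxConst) : ℝ)) * g z₀ ^ 2)) z₀ := by
  set κ : ℝ := 1 / (Real.sqrt 2 * kcFluxConst) with hκ
  set q : ℂ → ℂ := fun z => (I * (κ : ℂ)) * g z ^ 2 with hq
  have hqd : DifferentiableOn ℂ q U := (differentiableOn_const _).mul (hgd.pow 2)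
  refine hasFDerivAt_reMul_of_staircase (U := U) (q := q) hqd (fun z hz => ?_) hz₀
  obtain ⟨R, hR, hRU⟩ := Metric.isOpen_iff.1 hUo z hz
  refine ⟨R / 4, by positivity, (ball_subset_ball (by linarith)).trans hRU, fun p hp w hw hre him => ?_⟩
  -- the thickened rectangle stays in the chart
  have hrect : Rectangle p w ⊆ ball z (2 * (R / 4)) := rectangle_subset_ball hp hw
  have hthick : cthickening (R / 4) (Rectangle p w) ⊆ U := by
    intro y hy
    have hy' : y ∈ thickening (R / 2) (Rectangle p w) := cthickening_subset_thickening' (by positivity) (by linarith) _ hy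
    obtain ⟨x, hx, hxy⟩ := mem_thickening_iff.1 hy'
    have hxz : dist x z < 2 * (R / 4) := mem_ball.1 (hrect hx)
    refine hRU (mem_ball.2 ?_)
    calc dist y z ≤ dist y x + dist x z := dist_triangle _ _ _
      _ < R / 2 + 2 * (R / 4) := add_lt_add hxy hxz
      _ = R := by ring
  have key := h.hlim_staircase hg hUo hUA hs hgc hconv hlc hH hre him (by positivity : (0 : ℝ) < R / 4) hthick
  rw [key]
  -- `-κ Im S = Re(iκ S)`
  set S : ℂ := (∫ x : ℝ in p.re..w.re, g (x + p.im * I) ^ 2) + I * ∫ y : ℝ in p.im..w.im, g (w.re + y * I) ^ 2 with hS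
  have h1 : (∫ x : ℝ in p.re..w.re, q (x + p.im * I)) = (I * (κ : ℂ)) * ∫ x : ℝ in p.re..w.re, g (x + p.im * I) ^ 2 := by
    rw [hq]; exact intervalIntegral.integral_const_mul _ _
  have h2 : (∫ y : ℝ in p.im..w.im, q (w.re + y * I)) = (I * (κ : ℂ)) * ∫ y : ℝ in p.im..w.im, g (w.re + y * I) ^ 2 := by
    rw [hq]; exact intervalIntegral.integral_const_mul _ _
  rw [h1, h2, show (I * (κ : ℂ)) * (∫ x : ℝ in p.re..w.re, g (x + p.im * I) ^ 2) +
      I * ((I * (κ : ℂ)) * ∫ y : ℝ in p.im..w.im, g (w.re + y * I) ^ 2) = (I * (κ : ℂ)) * S by rw [hS]; ring]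
  rw [Complex.mul_re, Complex.mul_re, Complex.I_re, Complex.I_im, Complex.ofReal_re, Complex.ofReal_im, Complex.mul_im,
    Complex.I_re, Complex.I_im, Complex.ofReal_re, Complex.ofReal_im]
  ring

end KCSectionFamily

end Literature.Probability.LatticeModels
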